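import Summits.QuantumFields.BalabanUV.Beta.D1BFx.PeriodicArraySuperposition

/-!
# `BalabanUV.Beta.D1BFx.PeriodicArrayBiSuperposition` — road «BF-x» for binder row D1, slot (K), chain step (I) «(A1)-PACKED», brick (B4d)
# «PACKED-DICT₂» (`A1-PACKED-SPEC.md` v0.3.1 §8, FINDING F-g16-1 «WRAP»): **THE TORUS-PACKED SECOND JET IS THE ARRAY OF THE `ℤ^D` DOUBLE
# SUPERPOSITION WITH ONE WEIGHT PERIODISED** — `Σ_{k,l} r k · r′ l • Σ'_t arr s (K₂ ŵ_k (ŵ_l + s·t)) = arr s (Σ'_{u,u″} w u · w′_per u″ · K₂ u u″)`,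
# `r k = Σ'_m w (ŵ_k + s·m)`, `w′_per u″ = Σ'_m w′ (u″ + s·m)` — and NOT the array of the double superposition with both weights decaying (wrap-around).

HONEST DEPENDENCY (cell records, verbatim): «continuum YM on T⁴ ⇐ BetaPertH ∧ nine spine estimates (0/9 proved); BetaPertH ⇐ (D1) ∧ (D4) ∧
CAP+tail; G-an2-4 gates asym, D1 and NE2/3/4.»  HONEST FRAMING (cell contract, verbatim): «discharging `BetaPertH` makes Bałaban's UV stability
UNCONDITIONAL — a real constructive-QFT result; it is NOT the continuum limit and NOT the Clay problem.»  THIS MODULE DISCHARGES NOTHING of (K),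
of D1 or of the wall: [folklore] absolutely convergent `ℤ^D` bookkeeping (Fubini, image decomposition, re-indexing) over `PeriodicArrays.arr` and
(B4) `PeriodicArraySuperposition`.  No definition, no `def … : Prop`, nothing cited, 0 sorry.  NOT D1, NOT `BetaPertH`, NOT continuum, NOT Clay.

ABSOLUTE RULE (cell charter, verbatim): «No internally-minted statement may enter as a cited fact. Every hypothesis is either kernel-proved in this
package or a verbatim quotation of a PUBLISHED theorem with page reference. The manuscript(s) under audit are NOT citable for their own disputed
steps — they are the thing under adjudication; programme-internal (2001/route/tribunal) claims are never citable.»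

CONTENT (all [folklore]; generic `D`, `F`).
* §1 (B4) FOR LEFT-LOCALISED, PERIOD-COVARIANT FAMILIES: `arr_wsum_eq_sum_window_left` — weights `|w u| ≤ C·e^{−δ|u−p|₁}`, stencils `|K u x y a b| ≤ Cₖ·e^{−δ|x−u|₁}`
  (NO localisation in `y`), covariance under PERIOD translates only (`K (u + s·m) = shiftK (−s·m) (K u)`): the same window identity as (B4).
* §2 PERIODIC WEIGHTS AGAINST RIGHT-LOCALISED FAMILIES: `arr_psum_eq_sum_window_right` — an `s`-periodic bounded weight `ω` and a family `u′ ↦ L u′` with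
  `|L u′ x y a b| ≤ C_L·e^{−δ(|x−q|₁+|y−u′|₁)}`: `arr s (Σ'_{u′} ω u′ · L u′) = Σ_{z′} ω ẑ′ • Σ'_t arr s (L (ẑ′ + s·t))` (no covariance needed).
* §3 **`packed₂_eq_arr_periodised`** — the displayed identity (weights `w`, `w′` decaying; `K₂` bi-localised at `(u,u′)`, jointly period-covariant).
Unit `b2b-balaban-beta-d1-p2` (road owner, gen 16), 2026-08-22.
-/

noncomputable section

namespace Summit.QuantumFields.BalabanUV.Beta.D1BFx.PeriodicArrayBiSuperposition

open Filter Topology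
open scoped BigOperators
open Literature.MathematicalPhysics.QuantumFieldTheory.Balaban1983to89
open Literature.MathematicalPhysics.QuantumFieldTheory.Balaban1983to89.Beta
open B12Sec2to5 (l1 l1_nonneg summable_exp_neg_l1)
open ExpKernelCalculus (MKer BiLoc shiftK Zl Zl_pos Zl_nonneg summable_exp_shift summable_exp_shift' tsum_exp_shift tsum_exp_shift'
  l1_sub_triangle l1_sub_symm)
open OneStepResolventKernel (wsum)
open Summit.QuantumFields.BalabanUV.Beta.D1BFx.PeriodicArrays (arr arr_apply imageShift_eq_add_smul tsum_exp_imageShift_le)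
open Summit.QuantumFields.BalabanUV.Beta.D1BFx.PeriodicArraySuperposition (imageShift_add_smul arr_shiftK_period)

variable {D : ℕ} {F : Type*}

/-! ## §1 (B4) for left-localised, period-covariant stencil families -/

section Left

variable {w : ExpKernelCalculus.Site D → ℝ} {K : ExpKernelCalculus.Site D → MKer D F} {C Ck δ : ℝ} {p : ExpKernelCalculus.Site D} {s : ℕ}

/-- [folklore] Termwise majorant, left localisation only. -/
theorem abs_term_le_left (hw : ∀ u, |w u| ≤ C * Real.exp (-δ * l1 (u - p))) (hK : ∀ u x y a b, |K u x y a b| ≤ Ck * Real.exp (-δ * l1 (x - u)))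
    (X Y u : ExpKernelCalculus.Site D) (a b : F) :
    |w u * K u X Y a b| ≤ C * Ck * Real.exp (-δ * l1 (u - p)) * Real.exp (-δ * l1 (X - u)) := by
  rw [abs_mul]
  calc |w u| * |K u X Y a b| ≤ (C * Real.exp (-δ * l1 (u - p))) * (Ck * Real.exp (-δ * l1 (X - u))) :=
        mul_le_mul (hw u) (hK u X Y a b) (abs_nonneg _) ((abs_nonneg _).trans (hw u))
    _ = _ := by ring

/-- [folklore] The doubly indexed family `(u, t) ↦ w u · K u (x + s·t) (y + s·t) a b` is summable (left localisation suffices). -/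
theorem summable_images_left (hw : ∀ u, |w u| ≤ C * Real.exp (-δ * l1 (u - p))) (hK : ∀ u x y a b, |K u x y a b| ≤ Ck * Real.exp (-δ * l1 (x - u)))
    (hδ : 0 < δ) (hC : 0 ≤ C) (hCk : 0 ≤ Ck) [NeZero s] (x y : ExpKernelCalculus.Site D) (a b : F) :
    Summable fun ut : ExpKernelCalculus.Site D × ExpKernelCalculus.Site D =>
      w ut.1 * K ut.1 (imageShift s x ut.2) (imageShift s y ut.2) a b := by
  set M : ExpKernelCalculus.Site D × ExpKernelCalculus.Site D → ℝ :=
    fun ut => C * Ck * Real.exp (-δ * l1 (ut.1 - p)) * Real.exp (-δ * l1 (imageShift s x ut.2 - ut.1)) with hMdef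
  have hM0 : 0 ≤ M := fun ut => by positivity
  have hMs : Summable M := by
    refine (summable_prod_of_nonneg hM0).2 ⟨fun u => ?_, ?_⟩
    · exact ((tsum_exp_imageShift_le hδ s x u).1).mul_left (C * Ck * Real.exp (-δ * l1 (u - p)))
    · refine Summable.of_nonneg_of_le (fun u => tsum_nonneg fun t => hM0 (u, t)) (fun u => ?_)
        ((summable_exp_shift' hδ p).mul_left (C * Ck * Zl D δ))
      have h := (tsum_exp_imageShift_le hδ s x u).2
      have hpos : 0 ≤ C * Ck * Real.exp (-δ * l1 (u - p)) := by positivity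
      calc ∑' t, M (u, t) = C * Ck * Real.exp (-δ * l1 (u - p)) * ∑' t, Real.exp (-δ * l1 (imageShift s x t - u)) := by
            rw [← tsum_mul_left]
        _ ≤ C * Ck * Real.exp (-δ * l1 (u - p)) * Zl D δ := mul_le_mul_of_nonneg_left h hpos
        _ = C * Ck * Zl D δ * Real.exp (-δ * l1 (u - p)) := by ring
  refine Summable.of_norm_bounded hMs fun ut => ?_
  rw [Real.norm_eq_abs]
  exact abs_term_le_left hw hK _ _ _ a b

/-- [folklore] The image series of a left-localised kernel converges, with a bound uniform in the stencil index and the second variable. -/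
theorem summable_arr_left (hK : ∀ u x y a b, |K u x y a b| ≤ Ck * Real.exp (-δ * l1 (x - u))) (hδ : 0 < δ) (hCk : 0 ≤ Ck) [NeZero s]
    (u x y : ExpKernelCalculus.Site D) (a b : F) :
    (Summable fun t => K u (imageShift s x t) (imageShift s y t) a b) ∧ |arr s (K u) x y a b| ≤ Ck * Zl D δ := by
  have hmaj := ((tsum_exp_imageShift_le hδ s x u).1).mul_left Ck
  have hb : ∀ t, ‖K u (imageShift s x t) (imageShift s y t) a b‖ ≤ Ck * Real.exp (-δ * l1 (imageShift s x t - u)) := fun t => by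
    rw [Real.norm_eq_abs]; exact hK u _ _ a b
  refine ⟨Summable.of_norm_bounded hmaj hb, ?_⟩
  rw [arr_apply]
  have h := tsum_of_norm_bounded hmaj.hasSum hb
  rw [Real.norm_eq_abs] at h
  refine h.trans ?_
  rw [tsum_mul_left]
  exact mul_le_mul_of_nonneg_left (tsum_exp_imageShift_le hδ s x u).2 hCk

/-- [folklore] **(B4) FOR LEFT-LOCALISED, PERIOD-COVARIANT FAMILIES**: `arr s (wsum w K) x y a b = Σ_{z} (Σ'_m w (ẑ + s·m)) · arr s (K ẑ) x y a b` under decaying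
weights, LEFT localisation of the stencils (no condition in `y`) and covariance under PERIOD translates only. -/
theorem arr_wsum_eq_sum_window_left (hw : ∀ u, |w u| ≤ C * Real.exp (-δ * l1 (u - p)))
    (hK : ∀ u x y a b, |K u x y a b| ≤ Ck * Real.exp (-δ * l1 (x - u)))
    (hKcov : ∀ u m, K (imageShift s u m) = shiftK (-((s : ℤ) • m)) (K u)) (hδ : 0 < δ) (hC : 0 ≤ C) (hCk : 0 ≤ Ck) [NeZero s]
    (x y : ExpKernelCalculus.Site D) (a b : F) :
    arr s (wsum w K) x y a b
      = ∑ z : Beta.Site D s, (∑' m : ExpKernelCalculus.Site D, w (imageShift s (windowMap D s z) m)) * arr s (K (windowMap D s z)) x y a b := by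
  -- Fubini as in (B4)
  have hS := summable_images_left (s := s) hw hK hδ hC hCk x y a b
  have h1 : arr s (wsum w K) x y a b = ∑' u, w u * arr s (K u) x y a b := by
    calc arr s (wsum w K) x y a b = ∑' t, ∑' u, w u * K u (imageShift s x t) (imageShift s y t) a b := by
          simp only [arr_apply, wsum]
      _ = ∑' u, ∑' t, w u * K u (imageShift s x t) (imageShift s y t) a b := hS.tsum_comm
      _ = ∑' u, w u * arr s (K u) x y a b := tsum_congr fun u => by rw [tsum_mul_left, arr_apply]
  have h2 : Summable fun u => w u * arr s (K u) x y a b := by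
    refine Summable.of_norm_bounded ((summable_exp_shift' hδ p).mul_left (C * (Ck * Zl D δ))) fun u => ?_
    rw [Real.norm_eq_abs, abs_mul]
    calc |w u| * |arr s (K u) x y a b| ≤ (C * Real.exp (-δ * l1 (u - p))) * (Ck * Zl D δ) :=
          mul_le_mul (hw u) (summable_arr_left (s := s) hK hδ hCk u x y a b).2 (abs_nonneg _) ((abs_nonneg _).trans (hw u))
      _ = C * (Ck * Zl D δ) * Real.exp (-δ * l1 (u - p)) := by ring
  rw [h1, tsum_eq_sum_tsum_imageShift (s := s) h2]
  refine Finset.sum_congr rfl fun z _ => ?_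
  rw [← tsum_mul_right]
  refine tsum_congr fun m => ?_
  rw [hKcov, show -((s : ℤ) • m) = (s : ℤ) • (-m) by rw [smul_neg], arr_shiftK_period]

end Left

/-! ## §2 Periodic weights against right-localised families -/

section Right

variable {ω : ExpKernelCalculus.Site D → ℝ} {L : ExpKernelCalculus.Site D → MKer D F} {B CL δ : ℝ} {q : ExpKernelCalculus.Site D} {s : ℕ}

/-- [folklore] **PERIODIC WEIGHTS AGAINST A RIGHT-LOCALISED FAMILY**: for an `s`-periodic bounded weight `ω` (`ω (u′ + s·m) = ω u′`, `|ω u′| ≤ B`) and a family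
`L u′` with `|L u′ x y a b| ≤ C_L·e^{−δ(|x−q|₁+|y−u′|₁)}`:
`arr s (fun x y a b => Σ'_{u′} ω u′ · L u′ x y a b) x y a b = Σ_{z′} ω ẑ′ · Σ'_t arr s (L (ẑ′ + s·t)) x y a b` (no covariance). -/
theorem arr_psum_eq_sum_window_right [NeZero s] (hωper : ∀ u' m, ω (imageShift s u' m) = ω u') (hωB : ∀ u', |ω u'| ≤ B)
    (hL : ∀ u' x y a b, |L u' x y a b| ≤ CL * Real.exp (-δ * (l1 (x - q) + l1 (y - u')))) (hδ : 0 < δ) (hB : 0 ≤ B) (hCL : 0 ≤ CL)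
    (x y : ExpKernelCalculus.Site D) (a b : F) :
    arr s (fun x y a b => ∑' u', ω u' * L u' x y a b) x y a b
      = ∑ z' : Beta.Site D s, ω (windowMap D s z') * ∑' t : ExpKernelCalculus.Site D, arr s (L (imageShift s (windowMap D s z') t)) x y a b := by
  -- (i) the doubly indexed family `(τ, u′) ↦ ω u′ · L u′ (x + s·τ) (y + s·τ) a b` is summable
  set M : ExpKernelCalculus.Site D × ExpKernelCalculus.Site D → ℝ :=
    fun tu => B * CL * Real.exp (-δ * l1 (imageShift s x tu.1 - q)) * Real.exp (-δ * l1 (imageShift s y tu.1 - tu.2)) with hMdef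
  have hM0 : 0 ≤ M := fun tu => by positivity
  have hMs : Summable M := by
    refine (summable_prod_of_nonneg hM0).2 ⟨fun τ => ?_, ?_⟩
    · exact (summable_exp_shift hδ (imageShift s y τ)).mul_left (B * CL * Real.exp (-δ * l1 (imageShift s x τ - q)))
    · refine Summable.of_nonneg_of_le (fun τ => tsum_nonneg fun u' => hM0 (τ, u')) (fun τ => ?_)
        (((tsum_exp_imageShift_le hδ s x q).1).mul_left (B * CL * Zl D δ))
      have hpos : 0 ≤ B * CL * Real.exp (-δ * l1 (imageShift s x τ - q)) := by positivity
      calc ∑' u', M (τ, u') = B * CL * Real.exp (-δ * l1 (imageShift s x τ - q)) * ∑' u', Real.exp (-δ * l1 (imageShift s y τ - u')) := by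
            rw [← tsum_mul_left]
        _ = B * CL * Real.exp (-δ * l1 (imageShift s x τ - q)) * Zl D δ := by rw [tsum_exp_shift]
        _ ≤ B * CL * Zl D δ * Real.exp (-δ * l1 (imageShift s x τ - q)) := le_of_eq (by ring)
  have hS : Summable fun tu : ExpKernelCalculus.Site D × ExpKernelCalculus.Site D =>
      ω tu.2 * L tu.2 (imageShift s x tu.1) (imageShift s y tu.1) a b := by
    refine Summable.of_norm_bounded hMs fun tu => ?_
    rw [Real.norm_eq_abs, abs_mul]
    calc |ω tu.2| * |L tu.2 (imageShift s x tu.1) (imageShift s y tu.1) a b|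
        ≤ B * (CL * Real.exp (-δ * (l1 (imageShift s x tu.1 - q) + l1 (imageShift s y tu.1 - tu.2)))) :=
          mul_le_mul (hωB _) (hL _ _ _ a b) (abs_nonneg _) hB
      _ = M tu := by rw [hMdef]; simp only; rw [mul_add, Real.exp_add]; ring
  have hS' : Summable (Function.uncurry fun u' τ => ω u' * L u' (imageShift s x τ) (imageShift s y τ) a b) :=
    ((Equiv.prodComm (ExpKernelCalculus.Site D) (ExpKernelCalculus.Site D)).summable_iff).2 hS
  -- (ii) Fubini: `arr s (Σ'_{u′} …) = Σ'_{u′} ω u′ · arr s (L u′)`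
  have h1 : arr s (fun x y a b => ∑' u', ω u' * L u' x y a b) x y a b = ∑' u', ω u' * arr s (L u') x y a b := by
    calc arr s (fun x y a b => ∑' u', ω u' * L u' x y a b) x y a b
        = ∑' τ, ∑' u', ω u' * L u' (imageShift s x τ) (imageShift s y τ) a b := by simp only [arr_apply]
      _ = ∑' u', ∑' τ, ω u' * L u' (imageShift s x τ) (imageShift s y τ) a b := hS'.tsum_comm
      _ = ∑' u', ω u' * arr s (L u') x y a b := tsum_congr fun u' => by rw [tsum_mul_left, arr_apply]
  -- (iii) the single series is summable: `|arr s (L u′) x y| ≤ CL·Zl(δ∕2)·e^{−(δ∕2)|u′ − (y − x + q)|₁}`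
  have harr : ∀ u', |arr s (L u') x y a b| ≤ CL * Zl D (δ / 2) * Real.exp (-(δ / 2) * l1 ((y - x + q) - u')) := by
    intro u'
    have hδ2 : 0 < δ / 2 := half_pos hδ
    have hmaj := ((tsum_exp_imageShift_le hδ2 s x q).1).mul_left (CL * Real.exp (-(δ / 2) * l1 ((y - x + q) - u')))
    have hb : ∀ τ, ‖L u' (imageShift s x τ) (imageShift s y τ) a b‖
        ≤ CL * Real.exp (-(δ / 2) * l1 ((y - x + q) - u')) * Real.exp (-(δ / 2) * l1 (imageShift s x τ - q)) := by
      intro τ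
      rw [Real.norm_eq_abs]
      refine (hL u' _ _ a b).trans ?_
      rw [mul_assoc, ← Real.exp_add]
      refine mul_le_mul_of_nonneg_left (Real.exp_le_exp.2 ?_) hCL
      -- `|A|₁ + |B|₁ ≥ |B − A|₁` with `A = x + sτ − q`, `B = y + sτ − u′`, and `B − A = (y − x + q) − u′`
      have htri : l1 ((y - x + q) - u') ≤ l1 (imageShift s x τ - q) + l1 (imageShift s y τ - u') := by
        have e : (y - x + q) - u' = (imageShift s y τ - u') - (imageShift s x τ - q) := by
          rw [imageShift_eq_add_smul, imageShift_eq_add_smul]; abel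
        rw [e]
        calc l1 ((imageShift s y τ - u') - (imageShift s x τ - q))
            ≤ l1 (imageShift s y τ - u') + l1 (imageShift s x τ - q) := PeriodicArrays.l1_sub_le _ _
          _ = _ := add_comm _ _
      nlinarith [l1_nonneg (imageShift s x τ - q), l1_nonneg (imageShift s y τ - u'), hδ.le]
    rw [arr_apply]
    have h := tsum_of_norm_bounded hmaj.hasSum hb
    rw [Real.norm_eq_abs] at h
    refine h.trans ?_
    rw [tsum_mul_left]
    have hpos : 0 ≤ CL * Real.exp (-(δ / 2) * l1 ((y - x + q) - u')) := by positivity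
    calc CL * Real.exp (-(δ / 2) * l1 ((y - x + q) - u')) * ∑' τ, Real.exp (-(δ / 2) * l1 (imageShift s x τ - q))
        ≤ CL * Real.exp (-(δ / 2) * l1 ((y - x + q) - u')) * Zl D (δ / 2) :=
          mul_le_mul_of_nonneg_left (tsum_exp_imageShift_le hδ2 s x q).2 hpos
      _ = _ := by ring
  have h2 : Summable fun u' => ω u' * arr s (L u') x y a b := by
    refine Summable.of_norm_bounded ((summable_exp_shift (half_pos hδ) (y - x + q)).mul_left (B * (CL * Zl D (δ / 2)))) fun u' => ?_
    rw [Real.norm_eq_abs, abs_mul]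
    calc |ω u'| * |arr s (L u') x y a b| ≤ B * (CL * Zl D (δ / 2) * Real.exp (-(δ / 2) * l1 ((y - x + q) - u'))) :=
          mul_le_mul (hωB u') (harr u') (abs_nonneg _) hB
      _ = _ := by ring
  -- (iv) image decomposition of `u′`, periodicity of `ω`
  rw [h1, tsum_eq_sum_tsum_imageShift (s := s) h2]
  refine Finset.sum_congr rfl fun z' _ => ?_
  rw [← tsum_mul_left]
  exact tsum_congr fun t => by rw [hωper]

end Right

/-! ## §3 The torus-packed second jet = the array of the double superposition with one weight periodised -/

section Packed

variable {w w' : ExpKernelCalculus.Site D → ℝ} {K₂ : ExpKernelCalculus.Site D → ExpKernelCalculus.Site D → MKer D F} {C C' Ck δ : ℝ}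
  {p p' : ExpKernelCalculus.Site D} {s : ℕ} [NeZero s]

/-- [folklore] The PERIODISED WEIGHT `w′_per u := Σ'_m w′ (u + s·m)` of a decaying weight: summable, bounded by `C′·Zl D δ`, `s`-periodic. -/
theorem periodisedWeight_summable (hw' : ∀ u, |w' u| ≤ C' * Real.exp (-δ * l1 (u - p'))) (hδ : 0 < δ) (u : ExpKernelCalculus.Site D) :
    Summable fun m : ExpKernelCalculus.Site D => w' (imageShift s u m) :=
  Summable.of_norm_bounded (((tsum_exp_imageShift_le hδ s u p').1).mul_left C') fun m => by
    rw [Real.norm_eq_abs]; exact hw' _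

/-- [folklore] The periodised weight is bounded by `C′·Zl D δ`, uniformly. -/
theorem abs_periodisedWeight_le (hw' : ∀ u, |w' u| ≤ C' * Real.exp (-δ * l1 (u - p'))) (hδ : 0 < δ) (hC' : 0 ≤ C') (u : ExpKernelCalculus.Site D) :
    |∑' m : ExpKernelCalculus.Site D, w' (imageShift s u m)| ≤ C' * Zl D δ := by
  have hmaj := ((tsum_exp_imageShift_le hδ s u p').1).mul_left C'
  have h := tsum_of_norm_bounded hmaj.hasSum (fun m => by rw [Real.norm_eq_abs]; exact hw' (imageShift s u m))
  rw [Real.norm_eq_abs] at h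
  refine h.trans ?_
  rw [tsum_mul_left]
  exact mul_le_mul_of_nonneg_left (tsum_exp_imageShift_le hδ s u p').2 hC'

omit [NeZero s] in
/-- [folklore] The periodised weight is `s`-periodic (re-index the image sum). -/
theorem periodisedWeight_periodic (u m₀ : ExpKernelCalculus.Site D) :
    ∑' m : ExpKernelCalculus.Site D, w' (imageShift s (imageShift s u m₀) m) = ∑' m : ExpKernelCalculus.Site D, w' (imageShift s u m) := by
  simp only [imageShift_add]
  exact (Equiv.addLeft m₀).tsum_eq (fun m => w' (imageShift s u m))

/-- [folklore] **(B4d) «PACKED-DICT₂» — THE TORUS-PACKED SECOND JET IS THE ARRAY OF THE `ℤ^D` DOUBLE SUPERPOSITION WITH ONE WEIGHT PERIODISED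
(FINDING F-g16-1 «WRAP»).**  For decaying weights `w` (from `p`), `w′` (from `p′`), a bi-localised pair family `K₂ u u′` (`BiLoc (K₂ u u′) u u′ Cₖ δ`) jointly covariant
under PERIOD translates (`K₂ (u + s·m) (u′ + s·m) = shiftK (−s·m) (K₂ u u′)`), period `s ≥ 1`:
`Σ_{z z′} (Σ'_m w (ẑ + s·m)) · (Σ'_{m′} w′ (ẑ′ + s·m′)) · Σ'_t arr s (K₂ ẑ (ẑ′ + s·t)) x y a b = arr s (fun x y a b => Σ'_u w u · (Σ'_{u″} (Σ'_m w′ (u″ + s·m)) · K₂ u u″ x y a b)) x y a b`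
— LEFT: the torus objects (torus responses × the `t`-summed pair table); RIGHT: the array of the `ℤ^D` kernel with the SECOND weight periodised (§1 at the left-localised,
period-covariant family `u ↦ Σ'_{u″} w′_per u″ · K₂ u u″`, then §2 inside each window term). -/
theorem packed₂_eq_arr_periodised (hw : ∀ u, |w u| ≤ C * Real.exp (-δ * l1 (u - p))) (hw' : ∀ u, |w' u| ≤ C' * Real.exp (-δ * l1 (u - p')))
    (hK : ∀ u u', BiLoc (K₂ u u') u u' Ck δ) (hKcov : ∀ u u' m, K₂ (imageShift s u m) (imageShift s u' m) = shiftK (-((s : ℤ) • m)) (K₂ u u'))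
    (hδ : 0 < δ) (hC : 0 ≤ C) (hC' : 0 ≤ C') (x y : ExpKernelCalculus.Site D) (a b : F) :
    ∑ z : Beta.Site D s, ∑ z' : Beta.Site D s,
        (∑' m : ExpKernelCalculus.Site D, w (imageShift s (windowMap D s z) m))
          * ((∑' m' : ExpKernelCalculus.Site D, w' (imageShift s (windowMap D s z') m'))
            * ∑' t : ExpKernelCalculus.Site D, arr s (K₂ (windowMap D s z) (imageShift s (windowMap D s z') t)) x y a b)
      = arr s (wsum w (fun u => fun x y a b => ∑' u'', (∑' m : ExpKernelCalculus.Site D, w' (imageShift s u'' m)) * K₂ u u'' x y a b)) x y a b := by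
  have hCk : 0 ≤ Ck := (hK p p).nonneg a
  -- the inner family `Lfam u := Σ'_{u″} w′_per u″ · K₂ u u″` is LEFT-localised and PERIOD-covariant
  have hLloc : ∀ u x y a b, |(fun u => fun x y a b => ∑' u'', (∑' m : ExpKernelCalculus.Site D, w' (imageShift s u'' m)) * K₂ u u'' x y a b) u x y a b|
      ≤ (C' * Zl D δ * Ck * Zl D δ) * Real.exp (-δ * l1 (x - u)) := by
    intro u x y a b
    simp only
    have hmaj := (summable_exp_shift hδ y).mul_left (C' * Zl D δ * Ck * Real.exp (-δ * l1 (x - u)))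
    have hb : ∀ u'', ‖(∑' m : ExpKernelCalculus.Site D, w' (imageShift s u'' m)) * K₂ u u'' x y a b‖
        ≤ C' * Zl D δ * Ck * Real.exp (-δ * l1 (x - u)) * Real.exp (-δ * l1 (y - u'')) := by
      intro u''
      rw [Real.norm_eq_abs, abs_mul]
      calc |∑' m : ExpKernelCalculus.Site D, w' (imageShift s u'' m)| * |K₂ u u'' x y a b|
          ≤ (C' * Zl D δ) * (Ck * Real.exp (-δ * (l1 (x - u) + l1 (y - u'')))) :=
            mul_le_mul (abs_periodisedWeight_le hw' hδ hC' u'') (hK u u'' x y a b) (abs_nonneg _)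
              (mul_nonneg hC' (Zl_nonneg hδ))
        _ = _ := by rw [mul_add, Real.exp_add]; ring
    have h := tsum_of_norm_bounded hmaj.hasSum hb
    rw [Real.norm_eq_abs] at h
    refine h.trans (le_of_eq ?_)
    rw [tsum_mul_left, tsum_exp_shift]; ring
  have hLcov : ∀ u m, (fun u => fun x y a b => ∑' u'', (∑' m : ExpKernelCalculus.Site D, w' (imageShift s u'' m)) * K₂ u u'' x y a b) (imageShift s u m)
      = shiftK (-((s : ℤ) • m)) ((fun u => fun x y a b => ∑' u'', (∑' m : ExpKernelCalculus.Site D, w' (imageShift s u'' m)) * K₂ u u'' x y a b) u) := by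
    intro u m
    funext x y a b
    simp only [shiftK]
    rw [← (Equiv.addRight ((s : ℤ) • m)).tsum_eq (fun u'' => (∑' m' : ExpKernelCalculus.Site D, w' (imageShift s u'' m')) * K₂ (imageShift s u m) u'' x y a b)]
    refine tsum_congr fun u'' => ?_
    simp only [Equiv.coe_addRight]
    rw [← imageShift_eq_add_smul, periodisedWeight_periodic, hKcov u u'' m]
    rfl
  -- §1 then §2
  rw [arr_wsum_eq_sum_window_left (s := s) hw hLloc hLcov hδ hC
    (mul_nonneg (mul_nonneg (mul_nonneg hC' (Zl_nonneg hδ)) hCk) (Zl_nonneg hδ)) x y a b]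
  refine Finset.sum_congr rfl fun z _ => ?_
  rw [← Finset.mul_sum]
  congr 1
  exact (arr_psum_eq_sum_window_right (s := s) (ω := fun u'' => ∑' m : ExpKernelCalculus.Site D, w' (imageShift s u'' m))
    (L := fun u'' => K₂ (windowMap D s z) u'') (q := windowMap D s z) (fun u'' m => periodisedWeight_periodic u'' m)
    (fun u'' => abs_periodisedWeight_le hw' hδ hC' u'') (fun u'' x y a b => hK _ u'' x y a b) hδ (mul_nonneg hC' (Zl_nonneg hδ)) hCk x y a b).symm

end Packed



end Summit.QuantumFields.BalabanUV.Beta.D1BFx.PeriodicArrayBiSuperposition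

end
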